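import Summits.NavierStokesRegularity.FluidComputer.AmplitudeLedger

/-!
# LevelGrowthExponent — the machine window `1 ≤ β ≤ 3/2` for the growth exponent of the peak
speed against the active wavenumber (FLUID COMPUTER cell, idea-1 gen 8)

HONEST FRAMING: low prior, high value-of-information experiment on Tao's machine paradigm;
NOT a claim that NS blows up.

Dictionary (cell files `PREREG-R2.md` §10j, `PREREG-R2-READING.md` §8q, `atlas/IDEA-1.md` §12):
along a geometric ladder of wavenumbers `k_n = k₀ λⁿ` (`AmplitudeLedger.levelK`) with level
amplitudes `U n` (sup-velocity of level `n`), the *growth exponent* of level `n` is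
`β_n := log (U n) / log (k_n)` — "the peak speed grows like the `β`-th power of the active
wavenumber".  The cell's band-free census reads `β` off every run of the atlas
(`β_sup = ln A / ln K_sup` from the `umax`, `wmax` columns) and compares it with a WINDOW that the
machine paradigm must occupy:

* FLOOR `β ≥ 1`: if the level Reynolds numbers `Re_n = U n / (ν k_n)` (`AmplitudeLedger.levelRe`)
  stay `≥ c > 0` at infinitely many levels — the tree's blow-up floor
  (`LevelReynoldsFloor.levelReynolds_not_tendsto_zero`, `AmplitudeLedger.not_eventually_gain_le_rpow`)
  — then for every `ε > 0`, `β_n ≥ 1 - ε` at infinitely many levels (`frequently_le_beta_of_floor`).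
* CEILING `β ≤ 3/2`: if the level amplitudes obey a Bernstein × energy bound
  `U n ≤ C k_n^{3/2}` (the shape of `LevelRatioFloor.level_weight_le_energy`), then for every
  `ε > 0`, eventually `β_n ≤ 3/2 + ε` (`eventually_beta_le_of_ceiling`).
* STEP DICTIONARY: one step with amplitude gain `g = U (n+1) / U n` at scale ratio `λ` has step
  exponent `log g / log λ = 1 + log r / log λ` with `r = g / λ` the level-Reynolds ratio of the
  amplitude rung (`stepBeta_eq`); so the rung's floor `r ≥ 1` is `β_step ≥ 1` and the certified
  break point `r = 0.482` at `λ = 2.83` reads `β_step ≈ 0.30`.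

Everything here is hedged dictionary algebra / elementary real analysis over `AmplitudeLedger`'s
definitions (no fluid content, no new hypotheses about Navier–Stokes): it pins the window the
census is scored against so that the readers and the tree cannot drift apart.

Provenance: written by planner-pub-fluidc-idea-1-g8-0 (HOME/pub-fluidc-idea-1/lean/LevelGrowthExponent.lean);
to be filed through the gate by pub-fluidc-lit at idea-1's ASK.
-/

namespace Summit.NavierStokesRegularity.FluidComputer.LevelGrowthExponent

open Filter Real Topology
open Summit.NavierStokesRegularity.FluidComputer.AmplitudeLedger

variable {ν k0 lam : ℝ} {U : ℕ → ℝ}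

/-- The growth exponent of level `n`: `β_n = log (U n) / log (k_n)`. -/
noncomputable def levelBeta (k0 lam : ℝ) (U : ℕ → ℝ) (n : ℕ) : ℝ :=
  Real.log (U n) / Real.log (levelK k0 lam n)

/-- Along a geometric ladder with `k₀ > 0`, `λ > 1` the wavenumbers tend to `+∞`. -/
theorem tendsto_levelK_atTop (hk0 : 0 < k0) (hlam : 1 < lam) :
    Tendsto (levelK k0 lam) atTop atTop := by
  have h : Tendsto (fun n : ℕ => lam ^ n) atTop atTop := tendsto_pow_atTop_atTop_of_one_lt hlam
  show Tendsto (fun n => k0 * lam ^ n) atTop atTop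
  exact h.const_mul_atTop hk0

/-- … hence so do their logarithms. -/
theorem tendsto_log_levelK_atTop (hk0 : 0 < k0) (hlam : 1 < lam) :
    Tendsto (fun n => Real.log (levelK k0 lam n)) atTop atTop :=
  Real.tendsto_log_atTop.comp (tendsto_levelK_atTop hk0 hlam)

/-- Eventually `log k_n > 0`. -/
theorem eventually_log_levelK_pos (hk0 : 0 < k0) (hlam : 1 < lam) :
    ∀ᶠ n in atTop, 0 < Real.log (levelK k0 lam n) :=
  (tendsto_log_levelK_atTop hk0 hlam).eventually_gt_atTop 0

/-- For every constant `a` and every `ε > 0`, eventually `a ≤ ε log k_n`. -/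
theorem eventually_const_le_mul_log_levelK (hk0 : 0 < k0) (hlam : 1 < lam) (a : ℝ) {ε : ℝ}
    (hε : 0 < ε) : ∀ᶠ n in atTop, a ≤ ε * Real.log (levelK k0 lam n) := by
  have h := (tendsto_log_levelK_atTop hk0 hlam).eventually_ge_atTop (a / ε)
  filter_upwards [h] with n hn
  calc a = ε * (a / ε) := by field_simp
    _ ≤ ε * Real.log (levelK k0 lam n) := mul_le_mul_of_nonneg_left hn hε.le

/-- THE FLOOR, log form.  If `Re_n = U n / (ν k_n) ≥ c > 0` at infinitely many levels (positive
amplitudes, `ν, k₀ > 0`, `λ > 1`), then for every `ε > 0`, at infinitely many levels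
`(1 - ε) log k_n ≤ log (U n)`: the peak speed grows at least like the `(1-ε)`-th power of the
active wavenumber along a subsequence. -/
theorem frequently_log_ge_of_floor (hν : 0 < ν) (hk0 : 0 < k0) (hlam : 1 < lam)
    {c : ℝ} (hc : 0 < c)
    (hfreq : ∃ᶠ n in atTop, c ≤ levelRe ν k0 lam U n) {ε : ℝ} (hε : 0 < ε) :
    ∃ᶠ n in atTop, (1 - ε) * Real.log (levelK k0 lam n) ≤ Real.log (U n) := by
  have hlam0 : 0 < lam := one_pos.trans hlam
  have hsmall := eventually_const_le_mul_log_levelK hk0 hlam (-Real.log (c * ν)) hε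
  refine (hfreq.and_eventually hsmall).mono ?_
  rintro n ⟨hcn, hn⟩
  have hk : 0 < levelK k0 lam n := levelK_pos hk0 hlam0 n
  -- `c ≤ U n / (ν k_n)` gives `c ν k_n ≤ U n`
  have hmul : c * ν * levelK k0 lam n ≤ U n := by
    have := (le_div_iff₀ (mul_pos hν hk)).1 hcn
    simpa [levelRe, mul_comm, mul_left_comm, mul_assoc] using this
  have hlog : Real.log (c * ν) + Real.log (levelK k0 lam n) ≤ Real.log (U n) := by
    rw [← Real.log_mul (mul_pos hc hν).ne' hk.ne']
    exact Real.log_le_log (mul_pos (mul_pos hc hν) hk) hmul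
  linarith

/-- THE FLOOR as a bound on the growth exponent: `β_n ≥ 1 - ε` at infinitely many levels. -/
theorem frequently_le_beta_of_floor (hν : 0 < ν) (hk0 : 0 < k0) (hlam : 1 < lam)
    {c : ℝ} (hc : 0 < c)
    (hfreq : ∃ᶠ n in atTop, c ≤ levelRe ν k0 lam U n) {ε : ℝ} (hε : 0 < ε) :
    ∃ᶠ n in atTop, 1 - ε ≤ levelBeta k0 lam U n := by
  refine ((frequently_log_ge_of_floor hν hk0 hlam hc hfreq hε).and_eventually
    (eventually_log_levelK_pos hk0 hlam)).mono ?_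
  rintro n ⟨hn, hpos⟩
  exact (le_div_iff₀ hpos).2 hn

/-- THE CEILING, log form.  A Bernstein × energy bound `U n ≤ C k_n^{3/2}` (`C > 0`, positive
amplitudes) forces, for every `ε > 0`, eventually `log (U n) ≤ (3/2 + ε) log k_n`. -/
theorem eventually_log_le_of_ceiling (hk0 : 0 < k0) (hlam : 1 < lam) (hU : ∀ n, 0 < U n)
    {C : ℝ} (hC : 0 < C) (hceil : ∀ n, U n ≤ C * levelK k0 lam n ^ (3 / 2 : ℝ)) {ε : ℝ}
    (hε : 0 < ε) :
    ∀ᶠ n in atTop, Real.log (U n) ≤ (3 / 2 + ε) * Real.log (levelK k0 lam n) := by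
  have hlam0 : 0 < lam := one_pos.trans hlam
  filter_upwards [eventually_const_le_mul_log_levelK hk0 hlam (Real.log C) hε] with n hn
  have hk : 0 < levelK k0 lam n := levelK_pos hk0 hlam0 n
  have hlog : Real.log (U n) ≤ Real.log C + (3 / 2 : ℝ) * Real.log (levelK k0 lam n) := by
    have h1 := Real.log_le_log (hU n) (hceil n)
    rw [Real.log_mul hC.ne' (Real.rpow_pos_of_pos hk _).ne', Real.log_rpow hk] at h1
    exact h1
  linarith

/-- THE CEILING as a bound on the growth exponent: eventually `β_n ≤ 3/2 + ε`. -/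
theorem eventually_beta_le_of_ceiling (hk0 : 0 < k0) (hlam : 1 < lam) (hU : ∀ n, 0 < U n)
    {C : ℝ} (hC : 0 < C) (hceil : ∀ n, U n ≤ C * levelK k0 lam n ^ (3 / 2 : ℝ)) {ε : ℝ}
    (hε : 0 < ε) :
    ∀ᶠ n in atTop, levelBeta k0 lam U n ≤ 3 / 2 + ε := by
  filter_upwards [eventually_log_le_of_ceiling hk0 hlam hU hC hceil hε,
    eventually_log_levelK_pos hk0 hlam] with n hn hpos
  exact (div_le_iff₀ hpos).2 hn

/-- THE WINDOW.  Under the floor hypothesis (`Re_n ≥ c` frequently) and the ceiling hypothesis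
(`U n ≤ C k_n^{3/2}`), for every `ε > 0` infinitely many levels have
`1 - ε ≤ β_n ≤ 3/2 + ε` — the machine window the census is scored against. -/
theorem frequently_beta_mem_window (hν : 0 < ν) (hk0 : 0 < k0) (hlam : 1 < lam)
    (hU : ∀ n, 0 < U n) {c : ℝ} (hc : 0 < c)
    (hfreq : ∃ᶠ n in atTop, c ≤ levelRe ν k0 lam U n)
    {C : ℝ} (hC : 0 < C) (hceil : ∀ n, U n ≤ C * levelK k0 lam n ^ (3 / 2 : ℝ))
    {ε : ℝ} (hε : 0 < ε) :
    ∃ᶠ n in atTop, 1 - ε ≤ levelBeta k0 lam U n ∧ levelBeta k0 lam U n ≤ 3 / 2 + ε :=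
  (frequently_le_beta_of_floor hν hk0 hlam hc hfreq hε).and_eventually
    (eventually_beta_le_of_ceiling hk0 hlam hU hC hceil hε)

/-- NULL SIDE, log form (contrapositive reading of the floor): if eventually
`log (U n) ≤ θ log k_n` with `θ < 1` — the peak speed grows like a power `< 1` of the active
wavenumber, as on every sharpening run of the cell's atlas beyond two octaves — then the level
Reynolds numbers are NOT bounded below frequently by any `c > 0`. -/
theorem not_floor_of_eventually_beta_le (hν : 0 < ν) (hk0 : 0 < k0) (hlam : 1 < lam)
    {θ : ℝ} (hθ : θ < 1)
    (hev : ∀ᶠ n in atTop, Real.log (U n) ≤ θ * Real.log (levelK k0 lam n)) {c : ℝ} (hc : 0 < c) :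
    ¬ ∃ᶠ n in atTop, c ≤ levelRe ν k0 lam U n := by
  intro hfreq
  -- take ε with θ < 1 - 2ε and compare at a level where both hold and log k_n > 0
  have hε : 0 < (1 - θ) / 2 := by linarith
  have hfl := frequently_log_ge_of_floor hν hk0 hlam hc hfreq hε
  obtain ⟨n, hn⟩ :=
    ((hfl.and_eventually hev).and_eventually (eventually_log_levelK_pos hk0 hlam)).exists
  obtain ⟨⟨hge, hle⟩, hpos⟩ := hn
  have : (1 - (1 - θ) / 2) * Real.log (levelK k0 lam n) ≤ θ * Real.log (levelK k0 lam n) :=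
    hge.trans hle
  have h2 : (1 - (1 - θ) / 2 - θ) * Real.log (levelK k0 lam n) ≤ 0 := by linarith
  have h3 : 0 < (1 - (1 - θ) / 2 - θ) := by linarith
  exact absurd h2 (not_le.2 (mul_pos h3 hpos))

/-- STEP DICTIONARY.  One step with amplitude gain `g > 0` at scale ratio `λ > 1` has step
exponent `log g / log λ = 1 + log (g/λ) / log λ`: the rung's level-Reynolds ratio `r = g/λ`
and the step exponent carry the same information (`r ≥ 1 ↔ β_step ≥ 1`). -/
theorem stepBeta_eq (hlam : 1 < lam) {g : ℝ} (hg : 0 < g) :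
    Real.log g / Real.log lam = 1 + Real.log (g / lam) / Real.log lam := by
  have hl : Real.log lam ≠ 0 := (Real.log_pos hlam).ne'
  rw [Real.log_div hg.ne' (one_pos.trans hlam).ne']
  field_simp
  ring

/-- `r ≥ 1 ↔ β_step ≥ 1` for one step (`λ > 1`, `g > 0`, `r = g/λ`). -/
theorem one_le_ratio_iff_one_le_stepBeta (hlam : 1 < lam) {g : ℝ} (hg : 0 < g) :
    1 ≤ g / lam ↔ 1 ≤ Real.log g / Real.log lam := by
  have hlam0 : 0 < lam := one_pos.trans hlam
  have hlog : 0 < Real.log lam := Real.log_pos hlam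
  rw [one_le_div hlam0, one_le_div hlog]
  exact (Real.log_le_log_iff hlam0 hg).symm

/-- Per-step reading of the ledger: `U (n+1) = g · U n` with `k_{n+1} = λ k_n` moves the level
exponent by `log β`-bookkeeping: `log U (n+1) = log U n + log g` while `log k_{n+1} = log k_n + log λ`. -/
theorem log_levelK_succ (hk0 : 0 < k0) (hlam : 1 < lam) (n : ℕ) :
    Real.log (levelK k0 lam (n + 1)) = Real.log (levelK k0 lam n) + Real.log lam := by
  have hlam0 : 0 < lam := one_pos.trans hlam
  rw [levelK_succ, Real.log_mul hlam0.ne' (levelK_pos hk0 hlam0 n).ne', add_comm]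

end Summit.NavierStokesRegularity.FluidComputer.LevelGrowthExponent
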